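import Summits.ABC.IUTFork.Repair.RHTameBandLicenceSigmaBall
import Summits.ABC.IUTFork.Cor312LicenceTameBoundary
import HarnessLib

/-!
# R-H ROUND 2, row 5 (ball half): `Σ₅♭` is EXACT on uniformly BALL packets — a violated cell at a ball place REFUTES the licence there

Seat abc-iut-rh-typ-5 (R-H PAIR n = 5 TYPER, gen 4). PROOF-ONLY sequel (0 definitions, nothing re-typed) of this seat's `RHTameBandLicenceSigmaBall`
(p473920: `UniformlyBallAt`, `sigmaFiveBall`, `licenceOn_sigmaFiveBall`), composing BY NAME abc-iut-D1-prv's boundary star form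
`Real.not_qRegion_subset_thetaHull_settingDHVolSharp_of_ball_star` (`Cor312LicenceTameBoundary` §2, p456193: the (xi-f) inclusion at `(j, p)`
FAILS from ONE ball place `x₀` with `m_q + j(e−1) ≤ e·((m_Θ−1) div e)`, both radii exact `‖ϖ‖`), abc-iut-w6-d060's torsion-free ball criterion
`TorsionFree.logUnits_eq_closedBall_of_le_pred`, and this seat's `norm_ideles_eq_zpow_uniformizer` (p472055).

WHAT IT CLOSES (HOME/abc-iut-rh-typ-5/HANDOFF.md gen 3, «next (ii): ball-packet converse exactness»; rh2-ref-1 23:57:19Z on p473920; ROUND1 row 5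
«KEEP-as-declared-EQUIVALENCE on the TAME/BALL stratum»): gen 3 proved the SUFFICIENT direction on ball packets (`licenceOn_sigmaFiveBall`) and
the EXACT one only on TAME packets (`TameBandLicenceSigma.mem_sigmaFive_iff_mem_licenceCells_of_uniformlyTame`, via abc-iut-w4-d006's tame
star form, `e ≤ p − 2`). Here the CONVERSE at the boundary:
* `not_mem_licenceCells_of_uniformlyBall_of_not_cell` — at a uniformly BALL prime `p` (`p > 2`, one index `e ≤ p − 1`, no `ζ_p` in any `K_x`,
  `x ∣ p`), a bad place `w ∣ p` whose cell `Cell e_w P_w (i+1)` FAILS puts the packet `(i, p)` OUTSIDE the licence cells of the window bed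
  `settingPrVolSharp (pilotDataOfK D K) …` with realising ideles (the violated exact window IS the star threshold, `cell_iff_tame_exact`);
* **`mem_sigmaFiveBall_iff_mem_licenceCells_of_uniformlyBall`** — hence Σ₅♭ is EXACT on uniformly ball packets: `(i, p) ∈ Σ₅♭ ⟺ (i, p)` is
  a licence cell. With gen 3's tame exactness the row-5 stratum of record is exact on its whole declared scope (tame ∪ ball packets); the
  signed round-1 word «KEEP-as-declared-EQUIVALENCE on the TAME/BALL stratum» is now a two-sided kernel statement packet by packet.
HONEST FRAMING: statements about OUR typed hull (`settingPrVolSharp`, Dupuy–Hilado's typed (Ind1)/(Ind2) acting slot-wise — a STRONGER-THAN-PRINT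
per-packet reading, referee lanes A1/A2); refuted-as-typed ≠ refuted-in-print; nothing here asserts that abc is proved or refuted, or that
[IUTchIII] Cor. 3.12 holds or fails anywhere; no side taken on any author; typed ≠ proved. [cite: Mochizuki2012, IUTchIII Cor. 3.12 Step (xi-f)
p. 184; IUTchIV Prop. 1.1 p. 9, Prop. 1.2 (i)(ii) p. 10] [cite: DupuyHilado2025, §3.4, §3.9, §4.9] [cite: NeukirchANT1999, Ch. II Prop. (5.7)]
[claim: Mochizuki2012, status: disputed] for every IUT sentence quoted. Axioms: standard.
-/

noncomputable section
open Set Metric Function NumberField IsDedekindDomain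
open scoped Pointwise

namespace Summit.ABC.IUTFork.Repair.RH.TameBandLicenceSigmaBall

open Literature.AnabelianGeometry.AbsoluteAnabelian Literature.IUT.LogThetaLattice Literature.IUT.LogVolume
  Literature.IUT.HodgeTheaters Literature.NumberTheory.NumberFields Literature.NumberTheory.GaloisRepresentations.Ultrametric
open Summit.ABC.IUTFork.Thm311 Summit.ABC.IUTFork.Thm311.Real Summit.ABC.IUTFork.Cor312 Summit.ABC.IUTFork.Cor312.Setting
  Summit.ABC.IUTFork.Cor312Vol Summit.ABC.IUTFork.Cor312Prov Summit.ABC.IUTFork.Repair.RH.TameBandLicence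
  Summit.ABC.IUTFork.Repair.RH.SigmaLicence Summit.ABC.IUTFork.Repair.RH.TameBandLicenceSigma Literature.IUT.LogVolume.ThetaData

variable {F K Fbar : Type} [Field F] [NumberField F] [Field K] [NumberField K] [Algebra F K] [Field Fbar]
  [Algebra F Fbar] [Algebra K Fbar] {E : WeierstrassCurve F} [E.IsElliptic] {l : ℕ} {Pb : BadPlacePredicates K}
  (D : InitialThetaData F K Fbar E l Pb)

variable {logv : PadicLogs K} (hlog : LogvAnalytic logv)
  (M : Type) [Field M] [NumberField M]
  (archPk : ∀ (j : (thetaIndex (pilotDataOfK D K)).Label) (vQ : (thetaIndex (pilotDataOfK D K)).VQ),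
    Set ((logShellsDH (pilotDataOfK D K) logv).Packet j vQ))
  (archSub : ∀ (j : (thetaIndex (pilotDataOfK D K)).Label) (v : (thetaIndex (pilotDataOfK D K)).V),
    Set ((logShellsDH (pilotDataOfK D K) logv).Packet j ((thetaIndex (pilotDataOfK D K)).over v)))
  (Ψ : ℤ → ∀ v : (thetaIndex (pilotDataOfK D K)).V, v ∈ (thetaIndex (pilotDataOfK D K)).Vbad →
    Set ((logShellsDH (pilotDataOfK D K) logv).StarPacket v))
  (act : ℤ → ∀ v : (thetaIndex (pilotDataOfK D K)).V, v ∈ (thetaIndex (pilotDataOfK D K)).Vbad →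
    (logShellsDH (pilotDataOfK D K) logv).StarPacket v → Module.End ℚ ((logShellsDH (pilotDataOfK D K) logv).StarPacket v))
  (Mmod : ℤ → ∀ j : (thetaIndex (pilotDataOfK D K)).LabelStar, Set ((logShellsDH (pilotDataOfK D K) logv).GlobalPacket j.1))
  (region : ℤ → ∀ j : (thetaIndex (pilotDataOfK D K)).LabelStar, FinDivisor M → ∀ vQ : (thetaIndex (pilotDataOfK D K)).VQ,
    Set ((logShellsDH (pilotDataOfK D K) logv).Packet j.1 vQ))
  (n : ℤ) {HT : Type} {LogLink : HT → HT → Type} {IsFull : ∀ {s t : HT}, LogLink s t → Prop}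
  (lat : LGPGaussianLogThetaLattice LogLink IsFull)
  {Frd : Type} {IsoF : Frd → Frd → Type} {Ob : Frd → Type} {realify : Frd → Frd} {Strip : Type}
  {IsoS : Strip → Strip → Type} {Mv : ∀ v : (thetaIndex (pilotDataOfK D K)).V, v ∈ (thetaIndex (pilotDataOfK D K)).Vbad → Type}
  [∀ v h, Monoid (Mv v h)]
  (sig : GlobalLGPFrobenioidSignature (thetaIndex (pilotDataOfK D K)).lstar (thetaIndex (pilotDataOfK D K)).V
    (· ∈ (thetaIndex (pilotDataOfK D K)).Vbad) Frd IsoF Ob realify Strip IsoS Mv)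
  (split : SplittingMonoids Mv) {ObΔ : Type} {N : ∀ v : (thetaIndex (pilotDataOfK D K)).V, v ∈ (thetaIndex (pilotDataOfK D K)).Vbad → Type}
  [∀ v h, Monoid (N v h)] (qData : QPilotData ObΔ N)
  (tq : ∀ (pp : Nat.Primes) (x : (thetaIndex (pilotDataOfK D K)).Fibre (.inr pp)),
    haveI : Fact (pp : ℕ).Prime := ⟨pp.2⟩; kOf (pilotDataOfK D K) pp.1 x)
  (t : ∀ (pp : Nat.Primes) (_ : Fin (pilotDataOfK D K).lstar) (x : (thetaIndex (pilotDataOfK D K)).Fibre (.inr pp)),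
    haveI : Fact (pp : ℕ).Prime := ⟨pp.2⟩; kOf (pilotDataOfK D K) pp.1 x)
  (htq0 : ∀ pp x, tq pp x ≠ 0)
  (htq1 : ∀ (pp : Nat.Primes) (x : (thetaIndex (pilotDataOfK D K)).Fibre (.inr pp)),
    haveI : Fact (pp : ℕ).Prime := ⟨pp.2⟩; placeOf (pilotDataOfK D K) pp.1 x ∉ (pilotDataOfK D K).S → ‖tq pp x‖ = 1)
  (ht0 : ∀ pp i x, t pp i x ≠ 0)
  (ht : ∀ (pp : Nat.Primes) (i : Fin (pilotDataOfK D K).lstar) (x : (thetaIndex (pilotDataOfK D K)).Fibre (.inr pp)),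
    haveI : Fact (pp : ℕ).Prime := ⟨pp.2⟩
    Real.log ‖t pp i x‖ = -((pilotDataOfK D K).thetaPilot i (placeOf (pilotDataOfK D K) pp.1 x)) *
      logNorm K (placeOf (pilotDataOfK D K) pp.1 x) / localDegree K (placeOf (pilotDataOfK D K) pp.1 x))
  (htq : ∀ (pp : Nat.Primes) (x : (thetaIndex (pilotDataOfK D K)).Fibre (.inr pp)),
    haveI : Fact (pp : ℕ).Prime := ⟨pp.2⟩
    Real.log ‖tq pp x‖ = -((pilotDataOfK D K).qPilot (placeOf (pilotDataOfK D K) pp.1 x)) *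
      logNorm K (placeOf (pilotDataOfK D K) pp.1 x) / localDegree K (placeOf (pilotDataOfK D K) pp.1 x))

include ht0 ht htq in
/-- **At a uniformly BALL packet a VIOLATED cell REFUTES the licence** (abc-iut-D1-prv's boundary star form
`Real.not_qRegion_subset_thetaHull_settingDHVolSharp_of_ball_star` at the offending place; the ball fibre condition `log_p(𝒪^×) = {‖y‖ ≤ ‖ϖ‖}`
from `TorsionFree.logUnits_eq_closedBall_of_le_pred`; idele norms from `norm_ideles_eq_zpow_uniformizer`). The tame case is gen 3's
`TameBandLicenceSigma.not_mem_licenceCells_of_uniformlyTame_of_not_cell`. [cite: Mochizuki2012, IUTchIV Prop. 1.1 p. 9, Prop. 1.2 (i)(ii) p. 10]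
[cite: DupuyHilado2025, §3.4, §4.9] [cite: NeukirchANT1999, Ch. II Prop. (5.7)] [claim: Mochizuki2012, status: disputed] -/
theorem not_mem_licenceCells_of_uniformlyBall_of_not_cell (i : Fin (pilotDataOfK D K).lstar) (pp : Nat.Primes)
    (hballp : UniformlyBallAt D pp) (w : (thetaIndex (pilotDataOfK D K)).Fibre (.inr pp)) (P : ℕ)
    (hP : haveI : Fact (pp : ℕ).Prime := ⟨pp.2⟩; (pilotDataOfK D K).qPilot (placeOf (pilotDataOfK D K) pp.1 w) = P)
    (hnot : haveI : Fact (pp : ℕ).Prime := ⟨pp.2⟩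
      ¬ Cell (((placeOf (pilotDataOfK D K) pp.1 w).asIdeal.ramificationIdx ℤ : ℕ) : ℤ) (P : ℤ) (((i : ℕ) + 1 : ℕ) : ℤ)) :
    (i, Sum.inr pp) ∉
      licenceCells (settingPrVolSharp (pilotDataOfK D K) hlog M archPk archSub Ψ act Mmod region n lat sig split qData tq t htq0 htq1) := by
  haveI hF : Fact (pp : ℕ).Prime := ⟨pp.2⟩
  intro hlic
  change (settingDHVolSharp (pilotDataOfK D K) hlog M archPk archSub Ψ act Mmod region n lat sig split qData tq t htq0 htq1).qRegion
      (labelSucc i) (.inr pp) ⊆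
    (settingDHVolSharp (pilotDataOfK D K) hlog M archPk archSub Ψ act Mmod region n lat sig split qData tq t htq0 htq1).thetaHull
      (labelSucc i) (.inr pp) at hlic
  obtain ⟨hp2, e, hep, he⟩ := hballp
  -- a uniformizer of norm `p^{-1/e_w}` at `w`, and the ball-shaped unit-log shell (no `ζ_p`, `e ≤ p − 1`)
  obtain ⟨ϖ, hϖu, hϖn⟩ := exists_isUniformizer_rescaledCompletion K pp.1 (placeOf (pilotDataOfK D K) pp.1 w)
    (natCast_mem_placeOf (pilotDataOfK D K) pp.1 w)
  have heK : absRamificationIdx (pp : ℕ) (kOf (pilotDataOfK D K) pp.1 w) = e :=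
    (absRamificationIdx_rescaledCompletion K (pp : ℕ) (placeOf (pilotDataOfK D K) pp.1 w)
      (natCast_mem_placeOf (pilotDataOfK D K) pp.1 w)).trans (he w).1
  have hΛ : logUnits (kOf (pilotDataOfK D K) pp.1 w) =
      closedBall (0 : kOf (pilotDataOfK D K) pp.1 w) ‖(ϖ : kOf (pilotDataOfK D K) pp.1 w)‖ :=
    TorsionFree.logUnits_eq_closedBall_of_le_pred (pp : ℕ) hϖu (he w).2 (Nat.ne_of_gt hp2) (by rw [heK]; exact hep)
  -- realising ideles in uniformizer powers
  obtain ⟨hΘn, hqn⟩ := norm_ideles_eq_zpow_uniformizer D tq t htq0 ht0 ht htq pp i w ϖ hϖn P hP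
  have he0 : (0 : ℤ) < ((placeOf (pilotDataOfK D K) pp.1 w).asIdeal.ramificationIdx ℤ : ℤ) := by
    exact_mod_cast ramificationIdx_placeOf_pos D pp w
  -- the violated cell is the violated exact window, i.e. the star threshold
  have hc : ¬ ((((placeOf (pilotDataOfK D K) pp.1 w).asIdeal.ramificationIdx ℤ : ℕ) : ℤ) *
      (((((i : ℕ) + 1 : ℕ) : ℤ) ^ 2 * (P : ℤ) - 1) / (((placeOf (pilotDataOfK D K) pp.1 w).asIdeal.ramificationIdx ℤ : ℕ) : ℤ)) + 1 -
      (((i : ℕ) + 1 : ℕ) : ℤ) * ((((placeOf (pilotDataOfK D K) pp.1 w).asIdeal.ramificationIdx ℤ : ℕ) : ℤ) - 1) ≤ (P : ℤ)) :=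
    fun h => hnot ((cell_iff_tame_exact he0 (P : ℤ) (((i : ℕ) + 1 : ℕ) : ℤ)).2 h)
  have hdeep : ((P : ℕ) : ℤ) + ((i : ℤ) + 1) * ((absRamificationIdx (pp : ℕ) (kOf (pilotDataOfK D K) pp.1 w) : ℤ) - 1) ≤
      (absRamificationIdx (pp : ℕ) (kOf (pilotDataOfK D K) pp.1 w) : ℤ) *
        (((((((i : ℕ) + 1) ^ 2 * P : ℕ) : ℤ)) - 1) / (absRamificationIdx (pp : ℕ) (kOf (pilotDataOfK D K) pp.1 w) : ℤ)) := by
    rw [heK, ← (he w).1]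
    push_cast at hc ⊢
    linarith [lt_of_not_ge hc]
  exact not_qRegion_subset_thetaHull_settingDHVolSharp_of_ball_star (pilotDataOfK D K) hlog M archPk archSub Ψ act Mmod region n lat
    sig split qData tq t htq0 htq1 pp i w hp2 ϖ hϖu hΛ _ _ hΘn hqn hdeep hlic

include ht0 ht htq in
/-- **Σ₅♭ IS EXACT ON THE UNIFORMLY BALL PACKETS**: there a packet is in Σ₅♭ iff it is a licence cell of the window bed (⟹ gen 3's
`licenceOn_sigmaFiveBall`; ⟸ the refutation above at the first violated cell). Together with gen 3's
`TameBandLicenceSigma.mem_sigmaFive_iff_mem_licenceCells_of_uniformlyTame` the row-5 stratum is exact on its whole declared scope.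
[claim: Mochizuki2012, status: disputed] -/
theorem mem_sigmaFiveBall_iff_mem_licenceCells_of_uniformlyBall (i : Fin (pilotDataOfK D K).lstar) (pp : Nat.Primes)
    (hballp : UniformlyBallAt D pp) :
    (i, Sum.inr pp) ∈ sigmaFiveBall D ↔
      (i, Sum.inr pp) ∈
        licenceCells (settingPrVolSharp (pilotDataOfK D K) hlog M archPk archSub Ψ act Mmod region n lat sig split qData tq t htq0 htq1) := by
  haveI hF : Fact (pp : ℕ).Prime := ⟨pp.2⟩
  constructor
  · intro h
    exact licenceOn_sigmaFiveBall D hlog M archPk archSub Ψ act Mmod region n lat sig split qData tq t htq0 htq1 ht0 ht htq _ h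
  · intro hlic
    refine (mem_sigmaFiveBall_inr_iff D i pp).2 (Or.inr ⟨hballp, fun w _ P hP => ?_⟩)
    by_contra hnot
    exact not_mem_licenceCells_of_uniformlyBall_of_not_cell D hlog M archPk archSub Ψ act Mmod region n lat sig split qData tq t htq0 htq1
      ht0 ht htq i pp hballp w P hP hnot hlic

include ht0 ht htq in
/-- **On the declared scope of row 5 (every prime under a bad place uniformly tame OR uniformly ball) Σ₅♭ = the licence cells**, packet by
packet: the two-sided kernel form of ROUND1's «KEEP-as-declared-EQUIVALENCE on the TAME/BALL stratum» for MIXED data.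
[claim: Mochizuki2012, status: disputed] -/
theorem mem_sigmaFiveBall_iff_mem_licenceCells_of_scope (i : Fin (pilotDataOfK D K).lstar) (pp : Nat.Primes)
    (hscope : haveI : Fact (pp : ℕ).Prime := ⟨pp.2⟩
      (∀ w : (thetaIndex (pilotDataOfK D K)).Fibre (.inr pp), placeOf (pilotDataOfK D K) pp.1 w ∉ (pilotDataOfK D K).S) ∨
        UniformlyBallAt D pp) :
    (i, Sum.inr pp) ∈ sigmaFiveBall D ↔
      (i, Sum.inr pp) ∈
        licenceCells (settingPrVolSharp (pilotDataOfK D K) hlog M archPk archSub Ψ act Mmod region n lat sig split qData tq t htq0 htq1) := by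
  haveI hF : Fact (pp : ℕ).Prime := ⟨pp.2⟩
  rcases hscope with hS | hballp
  · constructor
    · intro h
      exact licenceOn_sigmaFiveBall D hlog M archPk archSub Ψ act Mmod region n lat sig split qData tq t htq0 htq1 ht0 ht htq _ h
    · intro _
      exact (mem_sigmaFiveBall_inr_iff D i pp).2 (Or.inl hS)
  · exact mem_sigmaFiveBall_iff_mem_licenceCells_of_uniformlyBall D hlog M archPk archSub Ψ act Mmod region n lat sig split qData tq t
      htq0 htq1 ht0 ht htq i pp hballp

end Summit.ABC.IUTFork.Repair.RH.TameBandLicenceSigmaBall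

end
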